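import Summits.ValiantsHypothesis.ValiantsHypothesis.Theorems.MonotoneRestorationOrbitCompressionQPNarrowToOrbit
import HarnessLib

/-!
# Route MonotoneRestoration — aside `OrbitCompressionQP` (stmt-ValiantsHypothesis-18332): DEGREE
# TRUNCATION of value derivations (supported computations may be taken homogeneous of degree `≤ deg f`)

In support currency (`OrbitSupport.orbitCompressionQP_iff_supportForm`) the aside asks to compress a
polylog-supported computation — of ANY length and through values of ANY degree — of a matrix-symmetric `VP`
polynomial `f n`.  Strassen's homogenisation is free in this currency: the homogeneous components of the
values, together with the products of components needed to recompute them, form again a value derivation;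
components inherit supports, products of components are supported on the union.  So every supported
computation of `f` can be replaced by one all of whose values have degree `≤ deg f` (supports at most
doubled) — the normal form any extraction / compression argument starts from (patterns with `≤ deg f`
edges; and the regime of `OrbitSupport.fixed_of_evenFixed_of_degree`).

* `homogeneousComponent_mul_filter` — the component of degree `i` of a product, as a sum of products of
  components;
* `exists_truncation` — **degree truncation of a value derivation** (any field): a value derivation
  containing every homogeneous component of degree `≤ d` of every value, all of whose values have degree
  `≤ d` and are components of old values or products of two such;
* `exists_truncation_supported` — **in the diagonal setting**: a supported derivation of `f` (supports
  `≤ s`, `deg f ≤ d`) yields a derivation of `f` through values of degree `≤ d` with supports `≤ 2s`.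

Helper file (`--supports stmt-ValiantsHypothesis-18332`); def-free; nothing here is a named fact.
-/

noncomputable section

open scoped Classical

-- `Summit.ValiantsHypothesis.ValiantsHypothesis.…` is the tree's single-conjunct layout (Sub = Summit).
set_option linter.dupNamespace false

namespace Summit.ValiantsHypothesis.ValiantsHypothesis.Theorems

namespace OrbitSupport

open Literature.Computability.AlgebraicComplexity MvPolynomial

universe u v

/-! ### Homogeneous components of products and of low-degree polynomials -/

/-- **The degree-`i` component of a product** is the sum of the products of the components of the factors
of complementary degrees. [folklore] -/
theorem homogeneousComponent_mul_filter {K : Type u} {X : Type v} [Field K] (u v : MvPolynomial X K)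
    (i : ℕ) :
    homogeneousComponent i (u * v) =
      ∑ jk ∈ ((Finset.range (u.totalDegree + 1)) ×ˢ (Finset.range (v.totalDegree + 1))).filter
          (fun jk : ℕ × ℕ => jk.1 + jk.2 = i),
        homogeneousComponent jk.1 u * homogeneousComponent jk.2 v := by
  rw [Finset.sum_filter, Finset.sum_product]
  conv_lhs => rw [← sum_homogeneousComponent u, ← sum_homogeneousComponent v, Finset.sum_mul_sum, map_sum]
  refine Finset.sum_congr rfl fun j _ => ?_
  rw [map_sum]
  refine Finset.sum_congr rfl fun k _ => ?_
  have hmem : homogeneousComponent j u * homogeneousComponent k v ∈ homogeneousSubmodule X K (j + k) :=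
    (homogeneousComponent_isHomogeneous j u).mul (homogeneousComponent_isHomogeneous k v)
  rw [homogeneousComponent_of_mem hmem]
  by_cases h : j + k = i
  · rw [if_pos h, if_pos h.symm]
  · rw [if_neg h, if_neg (Ne.symm h)]

/-- A polynomial of degree `≤ d` is the sum of its components of degree `≤ d`. [folklore] -/
theorem sum_homogeneousComponent_range {K : Type u} {X : Type v} [Field K] (p : MvPolynomial X K) {d : ℕ}
    (hd : p.totalDegree ≤ d) : ∑ i ∈ Finset.range (d + 1), homogeneousComponent i p = p := by
  rw [← Finset.sum_subset (Finset.range_subset_range.2 (Nat.succ_le_succ hd)) fun i _ hi => ?_]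
  · exact sum_homogeneousComponent p
  · rw [Finset.mem_range, not_lt] at hi
    exact homogeneousComponent_eq_zero i p (by omega)

/-- The component `homogeneousComponent i (X x)`. [folklore] -/
theorem homogeneousComponent_X' {K : Type u} {X : Type v} [Field K] (i : ℕ) (x : X) :
    homogeneousComponent i (MvPolynomial.X x : MvPolynomial X K) =
      if i = 1 then MvPolynomial.X x else 0 :=
  homogeneousComponent_of_mem (isHomogeneous_X K x)

/-- The component `homogeneousComponent i (C c)`. [folklore] -/
theorem homogeneousComponent_C' {K : Type u} {X : Type v} [Field K] (i : ℕ) (c : K) :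
    homogeneousComponent i (C c : MvPolynomial X K) = if i = 0 then C c else 0 :=
  homogeneousComponent_of_mem (isHomogeneous_C X c)

/-! ### Degree truncation -/

/-- **DEGREE TRUNCATION OF A VALUE DERIVATION.**  For every value derivation `𝒟` and every `d` there is a
value derivation `𝒟'` containing the homogeneous components of degree `≤ d` of all values of `𝒟`, every
value of which has total degree `≤ d` and is either such a component or a product of two components of
values of `𝒟` (Strassen's homogenisation, in value currency: the component of degree `i` of a weighted sum
is the weighted sum of the components; of a product `u · v`, the sum over `j + k = i` of the products
`u_j · v_k`, which are adjoined as intermediate values). [folklore] -/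
theorem exists_truncation {K : Type u} {X : Type v} [Field K] (𝒟 : ValueDerivation K X) (d : ℕ) :
    ∃ 𝒟' : ValueDerivation K X,
      (∀ q ∈ 𝒟.S, ∀ i ≤ d, homogeneousComponent i q ∈ 𝒟'.S) ∧
      ∀ p ∈ 𝒟'.S, p.totalDegree ≤ d ∧
        ((∃ q ∈ 𝒟.S, ∃ i : ℕ, p = homogeneousComponent i q) ∨
         (∃ u ∈ 𝒟.S, ∃ v ∈ 𝒟.S, ∃ j k : ℕ,
            p = homogeneousComponent j u * homogeneousComponent k v)) := by
  -- a chosen valid step for every value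
  have hstep : ∀ q, ∃ st : StepData K X, q ∈ 𝒟.S → st.Valid 𝒟.S 𝒟.rank q := fun q => by
    by_cases h : q ∈ 𝒟.S
    · obtain ⟨st, hst⟩ := 𝒟.step q h; exact ⟨st, fun _ => hst⟩
    · exact ⟨StepData.const 0, fun h' => absurd h' h⟩
  choose st hst using hstep
  -- the pieces adjoined for a product step
  let pieces : MvPolynomial X K → Finset (MvPolynomial X K) := fun q =>
    match st q with
    | StepData.prod u v =>
        (((Finset.range (u.totalDegree + 1)) ×ˢ (Finset.range (v.totalDegree + 1))).filter
          (fun jk : ℕ × ℕ => jk.1 + jk.2 ≤ d)).image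
          fun jk => homogeneousComponent jk.1 u * homogeneousComponent jk.2 v
    | _ => ∅
  have hpieces : ∀ q p, p ∈ pieces q → ∃ u v : MvPolynomial X K, st q = StepData.prod u v ∧
      ∃ j k : ℕ, j ≤ u.totalDegree ∧ k ≤ v.totalDegree ∧ j + k ≤ d ∧
        p = homogeneousComponent j u * homogeneousComponent k v := by
    intro q p hp
    rcases hsq : st q with x | c | D | ⟨u, v⟩ <;> simp only [pieces, hsq] at hp
    · simp at hp
    · simp at hp
    · simp at hp
    · obtain ⟨⟨j, k⟩, hjk, rfl⟩ := Finset.mem_image.1 hp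
      simp only [Finset.mem_filter, Finset.mem_product, Finset.mem_range] at hjk
      exact ⟨u, v, rfl, j, k, by omega, by omega, hjk.2, rfl⟩
  have hpieces_mem : ∀ q u v, st q = StepData.prod u v → ∀ j k : ℕ, j ≤ u.totalDegree →
      k ≤ v.totalDegree → j + k ≤ d →
        homogeneousComponent j u * homogeneousComponent k v ∈ pieces q := by
    intro q u v h j k hj hk hjk
    simp only [pieces, h]
    exact Finset.mem_image.2 ⟨(j, k), by simp [Finset.mem_filter, Finset.mem_product]; omega, rfl⟩
  -- the new values and their candidate ranks
  let A : Finset (MvPolynomial X K) :=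
    𝒟.S.biUnion fun q => (Finset.range (d + 1)).image fun i => homogeneousComponent i q
  let P : Finset (MvPolynomial X K) := 𝒟.S.biUnion pieces
  let R : MvPolynomial X K → Set ℕ := fun p =>
    {r | (∃ q ∈ 𝒟.S, ∃ i ≤ d, p = homogeneousComponent i q ∧ r = 2 * 𝒟.rank q + 1) ∨
         (∃ q ∈ 𝒟.S, p ∈ pieces q ∧ r = 2 * 𝒟.rank q)}
  have hA : ∀ q ∈ 𝒟.S, ∀ i ≤ d, homogeneousComponent i q ∈ A ∪ P := fun q hq i hi =>
    Finset.mem_union_left _ (Finset.mem_biUnion.2 ⟨q, hq, Finset.mem_image.2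
      ⟨i, Finset.mem_range.2 (Nat.lt_succ_of_le hi), rfl⟩⟩)
  have hRA : ∀ q ∈ 𝒟.S, ∀ i ≤ d, sInf (R (homogeneousComponent i q)) ≤ 2 * 𝒟.rank q + 1 :=
    fun q hq i hi => Nat.sInf_le (Or.inl ⟨q, hq, i, hi, rfl, rfl⟩)
  have hRP : ∀ q ∈ 𝒟.S, ∀ p ∈ pieces q, sInf (R p) ≤ 2 * 𝒟.rank q :=
    fun q hq p hp => Nat.sInf_le (Or.inr ⟨q, hq, hp, rfl⟩)
  refine ⟨⟨A ∪ P, fun p => sInf (R p), ?_⟩, fun q hq i hi => hA q hq i hi, ?_⟩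
  · -- every new value has a valid step
    intro p hp
    have hne : (R p).Nonempty := by
      rcases Finset.mem_union.1 hp with hp | hp
      · obtain ⟨q, hq, hp⟩ := Finset.mem_biUnion.1 hp
        obtain ⟨i, hi, rfl⟩ := Finset.mem_image.1 hp
        exact ⟨_, Or.inl ⟨q, hq, i, Nat.lt_succ_iff.1 (Finset.mem_range.1 hi), rfl, rfl⟩⟩
      · obtain ⟨q, hq, hp⟩ := Finset.mem_biUnion.1 hp
        exact ⟨_, Or.inr ⟨q, hq, hp, rfl⟩⟩
    rcases Nat.sInf_mem hne with ⟨q, hq, i, hi, rfl, hr⟩ | ⟨q, hq, hpq, hr⟩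
    · -- `p = homogeneousComponent i q`: follow the step of `q`
      have hv := hst q hq
      rcases hsq : st q with x | c | D | ⟨u, v⟩
      · -- variable
        have hqx : q = MvPolynomial.X x := by rw [← hv.value_eq, hsq]; rfl
        by_cases hi1 : i = 1
        · refine ⟨StepData.var x, ⟨?_, fun w hw => by simp [StepData.args] at hw⟩⟩
          rw [hqx, homogeneousComponent_X', if_pos hi1]; rfl
        · refine ⟨StepData.const 0, ⟨?_, fun w hw => by simp [StepData.args] at hw⟩⟩
          rw [hqx, homogeneousComponent_X', if_neg hi1]; simp [StepData.value]
      · -- constant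
        have hqc : q = C c := by rw [← hv.value_eq, hsq]; rfl
        by_cases hi0 : i = 0
        · refine ⟨StepData.const c, ⟨?_, fun w hw => by simp [StepData.args] at hw⟩⟩
          rw [hqc, homogeneousComponent_C', if_pos hi0]; rfl
        · refine ⟨StepData.const 0, ⟨?_, fun w hw => by simp [StepData.args] at hw⟩⟩
          rw [hqc, homogeneousComponent_C', if_neg hi0]; simp [StepData.value]
      · -- weighted sum: the weighted sum of the components
        have hqD : q = (D.map fun cu => C cu.1 * cu.2).sum := by rw [← hv.value_eq, hsq]; rfl
        refine ⟨StepData.sum (D.map fun cu => (cu.1, homogeneousComponent i cu.2)), ⟨?_, fun w hw => ?_⟩⟩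
        · simp only [StepData.value, Multiset.map_map, Function.comp_def]
          rw [hqD, map_multiset_sum, Multiset.map_map]
          refine congrArg _ (Multiset.map_congr rfl fun cu _ => ?_)
          simp only [Function.comp_apply, homogeneousComponent_C_mul]
        · simp only [StepData.args, Multiset.map_map, Function.comp_def, Multiset.mem_map] at hw
          obtain ⟨cu, hcu, rfl⟩ := hw
          have harg : cu.2 ∈ (st q).args := by
            rw [hsq]; simp only [StepData.args, Multiset.mem_map]; exact ⟨cu, hcu, rfl⟩
          obtain ⟨huS, hlt⟩ := hv.args_lt _ harg
          refine ⟨hA _ huS i hi, ?_⟩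
          rw [hr]
          exact (hRA _ huS i hi).trans_lt (by omega)
      · -- product: the sum of the products of components
        have hquv : q = u * v := by rw [← hv.value_eq, hsq]; rfl
        let F := ((Finset.range (u.totalDegree + 1)) ×ˢ (Finset.range (v.totalDegree + 1))).filter
          (fun jk : ℕ × ℕ => jk.1 + jk.2 = i)
        refine ⟨StepData.sum (F.val.map fun jk =>
          ((1 : K), homogeneousComponent jk.1 u * homogeneousComponent jk.2 v)), ⟨?_, fun w hw => ?_⟩⟩
        · rw [NarrowToOrbit.value_sum_one, hquv, homogeneousComponent_mul_filter]
        · obtain ⟨⟨j, k⟩, hjk, rfl⟩ := NarrowToOrbit.mem_args_sum_one _ _ hw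
          simp only [F, Finset.mem_filter, Finset.mem_product, Finset.mem_range] at hjk
          have hmem : homogeneousComponent j u * homogeneousComponent k v ∈ pieces q :=
            hpieces_mem q u v hsq j k (by omega) (by omega) (by omega)
          refine ⟨Finset.mem_union_right _ (Finset.mem_biUnion.2 ⟨q, hq, hmem⟩), ?_⟩
          rw [hr]
          exact (hRP q hq _ hmem).trans_lt (by omega)
    · -- `p` is a piece of the product step of `q`
      obtain ⟨u, v, hsq, j, k, hj, hk, hjk, rfl⟩ := hpieces q p hpq
      have hv := hst q hq
      have hu : u ∈ 𝒟.S ∧ 𝒟.rank u < 𝒟.rank q := hv.args_lt u (by rw [hsq]; simp [StepData.args])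
      have hv' : v ∈ 𝒟.S ∧ 𝒟.rank v < 𝒟.rank q := hv.args_lt v (by rw [hsq]; simp [StepData.args])
      refine ⟨StepData.prod (homogeneousComponent j u) (homogeneousComponent k v), ⟨rfl, fun w hw => ?_⟩⟩
      simp only [StepData.args, Multiset.insert_eq_cons, Multiset.mem_cons, Multiset.mem_singleton] at hw
      rcases hw with rfl | rfl
      · refine ⟨hA u hu.1 j (by omega), ?_⟩
        rw [hr]
        exact (hRA u hu.1 j (by omega)).trans_lt (by omega)
      · refine ⟨hA v hv'.1 k (by omega), ?_⟩
        rw [hr]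
        exact (hRA v hv'.1 k (by omega)).trans_lt (by omega)
  · -- degrees and provenance
    intro p hp
    change p ∈ A ∪ P at hp
    rcases Finset.mem_union.1 hp with hp | hp
    · obtain ⟨q, hq, hp⟩ := Finset.mem_biUnion.1 hp
      obtain ⟨i, hi, rfl⟩ := Finset.mem_image.1 hp
      exact ⟨(homogeneousComponent_isHomogeneous i q).totalDegree_le.trans
        (Nat.lt_succ_iff.1 (Finset.mem_range.1 hi)), Or.inl ⟨q, hq, i, rfl⟩⟩
    · obtain ⟨q, hq, hpq⟩ := Finset.mem_biUnion.1 hp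
      obtain ⟨u, v, hsq, j, k, hj, hk, hjk, rfl⟩ := hpieces q p hpq
      have hv := hst q hq
      have hu : u ∈ 𝒟.S := (hv.args_lt u (by rw [hsq]; simp [StepData.args])).1
      have hv' : v ∈ 𝒟.S := (hv.args_lt v (by rw [hsq]; simp [StepData.args])).1
      exact ⟨((homogeneousComponent_isHomogeneous j u).mul
          (homogeneousComponent_isHomogeneous k v)).totalDegree_le.trans hjk,
        Or.inr ⟨u, hu, v, hv', j, k, rfl⟩⟩

/-! ### The diagonal setting: supports survive truncation -/

/-- **Supported computations may be taken of degree `≤ deg f`.**  A value derivation of `f` over `ℂ` on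
the `n × n` matrix all of whose values are fixed by the pointwise stabilisers of `≤ s` indices, with
`deg f ≤ d`, yields one containing `f` all of whose values have degree `≤ d` and supports of size `≤ 2s`.
[folklore] -/
theorem exists_truncation_supported {n s d : ℕ} (𝒟 : ValueDerivation ℂ (Fin n × Fin n))
    (hS : ∀ q ∈ 𝒟.S, ∃ Y : Finset (Fin n), Y.card ≤ s ∧
      ∀ ρ : Equiv.Perm (Fin n), (∀ x ∈ Y, ρ x = x) → ren ρ q = q)
    {f : MvPolynomial (Fin n × Fin n) ℂ} (hf : f ∈ 𝒟.S) (hfd : f.totalDegree ≤ d) :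
    ∃ 𝒟' : ValueDerivation ℂ (Fin n × Fin n), f ∈ 𝒟'.S ∧
      ∀ p ∈ 𝒟'.S, p.totalDegree ≤ d ∧ ∃ Y : Finset (Fin n), Y.card ≤ 2 * s ∧
        ∀ ρ : Equiv.Perm (Fin n), (∀ x ∈ Y, ρ x = x) → ren ρ p = p := by
  obtain ⟨𝒟₁, hcomp, hprov⟩ := exists_truncation 𝒟 d
  -- supports of the truncated values
  have hsupp : ∀ p ∈ 𝒟₁.S, ∃ Y : Finset (Fin n), Y.card ≤ 2 * s ∧
      ∀ ρ : Equiv.Perm (Fin n), (∀ x ∈ Y, ρ x = x) → ren ρ p = p := by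
    intro p hp
    rcases (hprov p hp).2 with ⟨q, hq, i, rfl⟩ | ⟨u, hu, v, hv, j, k, rfl⟩
    · obtain ⟨Y, hY, hfix⟩ := hS q hq
      refine ⟨Y, hY.trans (by omega), fun ρ hρ => ?_⟩
      change MvPolynomial.rename _ _ = _
      rw [rename_homogeneousComponent]
      exact congrArg _ (hfix ρ hρ)
    · obtain ⟨Yu, hYu, hfu⟩ := hS u hu
      obtain ⟨Yv, hYv, hfv⟩ := hS v hv
      refine ⟨Yu ∪ Yv, (Finset.card_union_le _ _).trans (by omega), fun ρ hρ => ?_⟩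
      have h1 := hfu ρ fun x hx => hρ x (Finset.mem_union_left _ hx)
      have h2 := hfv ρ fun x hx => hρ x (Finset.mem_union_right _ hx)
      rw [map_mul]
      change MvPolynomial.rename _ _ * MvPolynomial.rename _ _ = _
      rw [rename_homogeneousComponent, rename_homogeneousComponent]
      exact congrArg₂ (· * ·) (congrArg _ h1) (congrArg _ h2)
  -- adjoin `f` as the sum of its components
  obtain ⟨𝒟', h𝒟'⟩ := NarrowToOrbit.exists_extend 𝒟₁ {f} (by
    intro q hq
    rw [Finset.mem_singleton] at hq
    subst hq
    refine ⟨StepData.sum ((Finset.range (d + 1)).val.map fun i => ((1 : ℂ), homogeneousComponent i q)),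
      ?_, fun w hw => ?_⟩
    · rw [NarrowToOrbit.value_sum_one, sum_homogeneousComponent_range q hfd]
    · obtain ⟨i, hi, rfl⟩ := NarrowToOrbit.mem_args_sum_one _ _ hw
      exact hcomp q hf i (Nat.lt_succ_iff.1 (Finset.mem_range.1 hi)))
  refine ⟨𝒟', (h𝒟' f).2 (Or.inr (Finset.mem_singleton.2 rfl)), fun p hp => ?_⟩
  rcases (h𝒟' p).1 hp with hp | hp
  · exact ⟨(hprov p hp).1, hsupp p hp⟩
  · rw [Finset.mem_singleton] at hp
    subst hp
    obtain ⟨Y, hY, hfix⟩ := hS p hf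
    exact ⟨hfd, Y, hY.trans (by omega), hfix⟩

end OrbitSupport

end Summit.ValiantsHypothesis.ValiantsHypothesis.Theorems

end
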